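import Mathlib
import HarnessLib
import Literature.Analysis.FluidPDE.SwirlTransportProofs
import Summits.NavierStokesRegularity.NavierStokesRegularity.Theorems.PoloidalWindowRigidity.Negative.OffFourStrata

/-!
# Crux `PoloidalWindowRigidity` (K2, stmt-NavierStokesRegularity-19708) — negative side, cross-door (germ level):
# the drifting cellular profile is off all four strata ON EVERY WINDOW of every slice

Negative-side support (refuter seat ns-regularity-refuter1, cell ns-regularity-ideate; D-0081 §C). The helicity door's
open piece was sharpened (tree `…Theorems.LocalHelicityTubeDoorFrobeniusProfileRigidityGermQuadrichotomy`,
`frobeniusProfileRigidity_of_germQuadrichotomy`) from a SLICE quadrichotomy to a GERM quadrichotomy: every profile of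
the Frobenius class has a slice `s < 0` and an open non-empty window `U` on which (1) the vorticity is aligned with a
fixed direction, or (2) one directional derivative of the velocity vanishes, or (3) the slice is germ-axisymmetric
without swirl in some frame, or (4) the vorticity is an affine screw field. `…Negative.OffFourStrata` certified that
the slice version with the Oseen-mild clause deleted is false; this file certifies the same for the GERM version, by
real-analyticity of the witness:

* `analyticOnNhd_driftProfile`, `analyticOnNhd_curl_driftProfile`, `analyticOnNhd_fderiv_driftProfile_apply`,
  `analyticOnNhd_swirl_conj_driftProfile`: every slice of the drifting profile `w` of `…Negative.DriftProfile`, its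
  curl, its directional derivatives and the swirl of each of its Euclidean conjugates are real-analytic on `ℝ³`
  (trigonometric polynomials of affine functions); `eq_zero_of_eqOn_open` is the identity theorem in the form used.
* `driftProfile_no_aligned_vorticity_window`, `driftProfile_no_flat_direction_window`,
  `driftProfile_no_noSwirl_window` (+ `driftProfile_no_affineScrew_vorticity_ball` of `…OffFourStrata`): no window of
  any slice of `w` lies on stratum (1), (2), (3) or (4) — a window identity propagates to the whole slice by analyticity
  and contradicts `vorticityDirection_nonconstant_driftProfile`, `not_translationInvariant_driftProfile`
  (via `driftProfile_const_along_of_fderiv_apply_eq_zero`) and `driftProfile_swirl_every_axis`.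
* `germQuadrichotomy_false_without_mild`: the germ quadrichotomy, hypothesis list of
  `frobeniusProfileRigidity_of_germQuadrichotomy` verbatim with the Oseen-mild clause deleted, is FALSE (`C = 4`).
  So the germ classification, like the slice classification and the K2 residue, must use the Navier–Stokes identity
  jointly with the global (Type-I, ancient) structure: bounded, divergence-free, complex-lamellar, Type-I data alone
  put no window of any slice on a stratum. [folklore]
-/

noncomputable section

namespace Summit.NavierStokesRegularity.NavierStokesRegularity.Theorems.PoloidalWindowRigidity.Negative

open Set Function
open scoped RealInnerProductSpace InnerProductSpace
open Literature.Analysis Literature.Analysis.FluidPDE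

/-! ## Real-analyticity of the witness -/

/-- The coordinates of the drifting argument `A_s x = c(s)x + log(−s)e₁` are real-analytic (affine). [folklore] -/
theorem analyticAt_driftShift_coord (s : ℝ) (k : Fin 3) (x : EuclideanSpace ℝ (Fin 3)) :
    AnalyticAt ℝ (fun x : EuclideanSpace ℝ (Fin 3) => driftShift s x k) x := by
  have h1 : AnalyticAt ℝ (fun x : EuclideanSpace ℝ (Fin 3) => x k) x :=
    (EuclideanSpace.proj k : EuclideanSpace ℝ (Fin 3) →L[ℝ] ℝ).analyticAt x
  have h : (fun x : EuclideanSpace ℝ (Fin 3) => driftShift s x k) = fun x => cellAmp s * x k +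
      Real.log (-s) * (EuclideanSpace.single (1 : Fin 3) (1 : ℝ) : EuclideanSpace ℝ (Fin 3)) k := by
    funext x; simp [driftShift]
  rw [h]
  exact (analyticAt_const.mul h1).add analyticAt_const

/-- The drifting profile in the standard basis. [folklore] -/
theorem driftProfile_eq_sum (s : ℝ) (x : EuclideanSpace ℝ (Fin 3)) : driftProfile s x =
    (cellAmp s * (Real.cos (driftShift s x 2) * Real.cos (driftShift s x 0))) •
        EuclideanSpace.single (0 : Fin 3) (1 : ℝ) +
      (cellAmp s * (Real.cos (driftShift s x 2) * Real.cos (driftShift s x 1))) •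
        EuclideanSpace.single (1 : Fin 3) (1 : ℝ) +
      (cellAmp s * (Real.sin (driftShift s x 2) * (Real.sin (driftShift s x 0) + Real.sin (driftShift s x 1)))) •
        EuclideanSpace.single (2 : Fin 3) (1 : ℝ) := by
  ext i
  fin_cases i <;> simp [driftProfile, cellField_apply_zero, cellField_apply_one, cellField_apply_two]

/-- **Every slice of the drifting profile is real-analytic on `ℝ³`.** [folklore] -/
theorem analyticOnNhd_driftProfile (s : ℝ) : AnalyticOnNhd ℝ (driftProfile s) univ := by
  intro x _
  have hY := analyticAt_driftShift_coord s
  have e : driftProfile s = fun x =>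
      (cellAmp s * (Real.cos (driftShift s x 2) * Real.cos (driftShift s x 0))) •
          EuclideanSpace.single (0 : Fin 3) (1 : ℝ) +
        (cellAmp s * (Real.cos (driftShift s x 2) * Real.cos (driftShift s x 1))) •
          EuclideanSpace.single (1 : Fin 3) (1 : ℝ) +
        (cellAmp s * (Real.sin (driftShift s x 2) * (Real.sin (driftShift s x 0) + Real.sin (driftShift s x 1)))) •
          EuclideanSpace.single (2 : Fin 3) (1 : ℝ) := funext (driftProfile_eq_sum s)
  rw [e]
  refine ((analyticAt_const.mul ((Real.analyticAt_cos.comp (hY 2 x)).mul (Real.analyticAt_cos.comp (hY 0 x)))).smul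
    analyticAt_const).add ((analyticAt_const.mul ((Real.analyticAt_cos.comp (hY 2 x)).mul
      (Real.analyticAt_cos.comp (hY 1 x)))).smul analyticAt_const) |>.add ?_
  exact (analyticAt_const.mul ((Real.analyticAt_sin.comp (hY 2 x)).mul
    ((Real.analyticAt_sin.comp (hY 0 x)).add (Real.analyticAt_sin.comp (hY 1 x))))).smul analyticAt_const

/-- **The vorticity of every slice of the drifting profile is real-analytic on `ℝ³`.** [folklore] -/
theorem analyticOnNhd_curl_driftProfile (s : ℝ) : AnalyticOnNhd ℝ (curl (driftProfile s)) univ := by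
  intro x _
  have hY := analyticAt_driftShift_coord s
  have e : curl (driftProfile s) = fun x =>
      (cellAmp s ^ 2 * (2 * Real.sin (driftShift s x 2) * Real.cos (driftShift s x 1))) •
          (EuclideanSpace.single (0 : Fin 3) (1 : ℝ) : EuclideanSpace ℝ (Fin 3)) +
        (-(cellAmp s ^ 2 * (2 * Real.sin (driftShift s x 2) * Real.cos (driftShift s x 0)))) •
          (EuclideanSpace.single (1 : Fin 3) (1 : ℝ) : EuclideanSpace ℝ (Fin 3)) := funext (curl_driftProfile s)
  rw [e]
  refine ((analyticAt_const.mul ((analyticAt_const.mul (Real.analyticAt_sin.comp (hY 2 x))).mul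
    (Real.analyticAt_cos.comp (hY 1 x)))).smul analyticAt_const).add ?_
  exact ((analyticAt_const.mul ((analyticAt_const.mul (Real.analyticAt_sin.comp (hY 2 x))).mul
    (Real.analyticAt_cos.comp (hY 0 x)))).neg).smul analyticAt_const

/-- `y ↦ curl w(s)(y) × b` is real-analytic on `ℝ³` (a linear map of the analytic vorticity). [folklore] -/
theorem analyticOnNhd_cross_curl_driftProfile (s : ℝ) (b : EuclideanSpace ℝ (Fin 3)) :
    AnalyticOnNhd ℝ (fun y => cross (curl (driftProfile s) y) b) univ := by
  let T : EuclideanSpace ℝ (Fin 3) →L[ℝ] EuclideanSpace ℝ (Fin 3) :=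
    LinearMap.toContinuousLinearMap
      ((WithLp.linearEquiv 2 ℝ (Fin 3 → ℝ)).symm.toLinearMap ∘ₗ
        ((crossProduct.flip (WithLp.ofLp b)) ∘ₗ (WithLp.linearEquiv 2 ℝ (Fin 3 → ℝ)).toLinearMap))
  have hT : ∀ v, T v = cross v b := fun v => by simp [T, cross, LinearMap.flip_apply]
  have e : (fun y => cross (curl (driftProfile s) y) b) = ⇑T ∘ curl (driftProfile s) :=
    funext fun y => (hT _).symm
  rw [e]
  exact T.comp_analyticOnNhd (analyticOnNhd_curl_driftProfile s)

/-- **Every directional derivative of every slice of the drifting profile is real-analytic on `ℝ³`.** [folklore] -/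
theorem analyticOnNhd_fderiv_driftProfile_apply (s : ℝ) (e : EuclideanSpace ℝ (Fin 3)) :
    AnalyticOnNhd ℝ (fun y => fderiv ℝ (driftProfile s) y e) univ :=
  (ContinuousLinearMap.apply ℝ (EuclideanSpace ℝ (Fin 3)) e).comp_analyticOnNhd
    (analyticOnNhd_driftProfile s).fderiv

/-- Every Euclidean conjugate `z ↦ L⁻¹ w(s, L z + c)` of a slice of the drifting profile is real-analytic. [folklore] -/
theorem analyticOnNhd_conj_driftProfile (s : ℝ)
    (L : EuclideanSpace ℝ (Fin 3) ≃ₗᵢ[ℝ] EuclideanSpace ℝ (Fin 3)) (c : EuclideanSpace ℝ (Fin 3)) :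
    AnalyticOnNhd ℝ (fun z => L.symm (driftProfile s (L z + c))) univ := by
  intro z _
  have hL : AnalyticAt ℝ (fun z => L z) z := by simpa using L.toContinuousLinearEquiv.analyticAt z
  have h2 : AnalyticAt ℝ (fun z => L z + c) z := hL.add analyticAt_const
  have h3 : AnalyticAt ℝ (fun z => driftProfile s (L z + c)) z :=
    (analyticOnNhd_driftProfile s _ (mem_univ _)).comp h2
  have hLs : AnalyticAt ℝ (fun w => L.symm w) (driftProfile s (L z + c)) := by
    simpa using L.symm.toContinuousLinearEquiv.analyticAt _
  exact AnalyticAt.comp (f := fun z => driftProfile s (L z + c)) (x := z) hLs h3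

/-- **The swirl of every Euclidean conjugate of a slice of the drifting profile is real-analytic on `ℝ³`.**
[folklore] -/
theorem analyticOnNhd_swirl_conj_driftProfile (s : ℝ)
    (L : EuclideanSpace ℝ (Fin 3) ≃ₗᵢ[ℝ] EuclideanSpace ℝ (Fin 3)) (c : EuclideanSpace ℝ (Fin 3)) :
    AnalyticOnNhd ℝ (swirl (fun z => L.symm (driftProfile s (L z + c)))) univ := by
  intro z _
  have hu := analyticOnNhd_conj_driftProfile s L c z (mem_univ z)
  have hc : ∀ k : Fin 3, AnalyticAt ℝ (fun z : EuclideanSpace ℝ (Fin 3) => z k) z := fun k =>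
    (EuclideanSpace.proj k : EuclideanSpace ℝ (Fin 3) →L[ℝ] ℝ).analyticAt z
  have huk : ∀ k : Fin 3, AnalyticAt ℝ (fun z => L.symm (driftProfile s (L z + c)) k) z := fun k =>
    ((EuclideanSpace.proj k : EuclideanSpace ℝ (Fin 3) →L[ℝ] ℝ).analyticAt _).comp hu
  have e : swirl (fun z => L.symm (driftProfile s (L z + c))) =
      fun z => z 0 * L.symm (driftProfile s (L z + c)) 1 - z 1 * L.symm (driftProfile s (L z + c)) 0 := rfl
  rw [e]
  exact ((hc 0).mul (huk 1)).sub ((hc 1).mul (huk 0))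

/-- The identity theorem in the form used: a real-analytic function on `ℝ³` vanishing on a non-empty open set
vanishes everywhere. [folklore] -/
theorem eq_zero_of_eqOn_open {F : Type*} [NormedAddCommGroup F] [NormedSpace ℝ F]
    {f : EuclideanSpace ℝ (Fin 3) → F} (hf : AnalyticOnNhd ℝ f univ) {W : Set (EuclideanSpace ℝ (Fin 3))}
    (hW : IsOpen W) {y₀ : EuclideanSpace ℝ (Fin 3)} (hy₀ : y₀ ∈ W) (h0 : ∀ y ∈ W, f y = 0)
    (y : EuclideanSpace ℝ (Fin 3)) : f y = 0 := by
  have hev : f =ᶠ[nhds y₀] 0 :=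
    Filter.eventually_of_mem (hW.mem_nhds hy₀) (fun z hz => by simpa using h0 z hz)
  exact hf.eqOn_zero_of_preconnected_of_eventuallyEq_zero isPreconnected_univ (mem_univ y₀) hev (mem_univ y)

/-! ## No window of any slice lies on a stratum -/

/-- **Stratum (1) on no window**: on no non-empty open set of any slice `s < 0` is the vorticity of the drifting
profile aligned with a fixed non-zero direction. [folklore] -/
theorem driftProfile_no_aligned_vorticity_window {s : ℝ} (hs : s < 0) :
    ¬ ∃ (U : Set (EuclideanSpace ℝ (Fin 3))) (b : EuclideanSpace ℝ (Fin 3)), IsOpen U ∧ U.Nonempty ∧ b ≠ 0 ∧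
      ∀ y ∈ U, cross (curl (driftProfile s) y) b = 0 := by
  rintro ⟨U, b, hU, ⟨y₀, hy₀⟩, hb, hal⟩
  have hglob := eq_zero_of_eqOn_open (analyticOnNhd_cross_curl_driftProfile s b) hU hy₀ hal
  obtain ⟨x, hx⟩ := vorticityDirection_nonconstant_driftProfile hs b hb
  exact hx (hglob x)

/-- If one directional derivative of a slice of the drifting profile vanishes everywhere, the slice is constant
along that direction. [folklore] -/
theorem driftProfile_const_along_of_fderiv_apply_eq_zero {s : ℝ} {e : EuclideanSpace ℝ (Fin 3)}
    (hD : ∀ y, fderiv ℝ (driftProfile s) y e = 0) (y : EuclideanSpace ℝ (Fin 3)) (l : ℝ) :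
    driftProfile s (y + l • e) = driftProfile s y := by
  have hder : ∀ t : ℝ, HasDerivAt (fun t : ℝ => driftProfile s (y + t • e)) 0 t := by
    intro t
    have hline : HasDerivAt (fun t : ℝ => y + t • e) e t := by
      simpa using ((hasDerivAt_id t).smul_const e).const_add y
    have hw : HasFDerivAt (driftProfile s) (fderiv ℝ (driftProfile s) (y + t • e)) (y + t • e) :=
      (hasFDerivAt_driftProfile s (y + t • e)).differentiableAt.hasFDerivAt
    have h := hw.comp_hasDerivAt t hline
    rw [hD (y + t • e)] at h
    exact h
  have hdiff : Differentiable ℝ (fun t : ℝ => driftProfile s (y + t • e)) :=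
    fun t => (hder t).differentiableAt
  have h := is_const_of_deriv_eq_zero hdiff (fun t => (hder t).deriv) l 0
  simpa using h

/-- **Stratum (2) on no window**: on no non-empty open set of any slice `s < 0` does a directional derivative of the
drifting profile in a fixed non-zero direction vanish. [folklore] -/
theorem driftProfile_no_flat_direction_window {s : ℝ} (hs : s < 0) :
    ¬ ∃ (U : Set (EuclideanSpace ℝ (Fin 3))) (e : EuclideanSpace ℝ (Fin 3)), IsOpen U ∧ U.Nonempty ∧ e ≠ 0 ∧
      ∀ y ∈ U, fderiv ℝ (driftProfile s) y e = 0 := by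
  rintro ⟨U, e, hU, ⟨y₀, hy₀⟩, he, hdir⟩
  have hglob := eq_zero_of_eqOn_open (analyticOnNhd_fderiv_driftProfile_apply s e) hU hy₀ hdir
  obtain ⟨y, l, hy⟩ := not_translationInvariant_driftProfile hs e he
  exact hy (driftProfile_const_along_of_fderiv_apply_eq_zero hglob y l)

/-- **Stratum (3) on no window**: in no Euclidean frame `(L, c)` does the swirl of the conjugated slice
`z ↦ L⁻¹ w(s, L z + c)` (`s < 0`) vanish on a non-empty open set. [folklore] -/
theorem driftProfile_no_noSwirl_window {s : ℝ} (hs : s < 0)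
    (L : EuclideanSpace ℝ (Fin 3) ≃ₗᵢ[ℝ] EuclideanSpace ℝ (Fin 3)) (c : EuclideanSpace ℝ (Fin 3)) :
    ¬ ∃ U : Set (EuclideanSpace ℝ (Fin 3)), IsOpen U ∧ U.Nonempty ∧
      ∀ z ∈ U, swirl (fun z => L.symm (driftProfile s (L z + c))) z = 0 := by
  rintro ⟨U, hU, ⟨z₀, hz₀⟩, hsw⟩
  have hglob := eq_zero_of_eqOn_open (analyticOnNhd_swirl_conj_driftProfile s L c) hU hz₀ hsw
  exact driftProfile_swirl_every_axis hs L c hglob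

/-! ## The germ quadrichotomy minus the Oseen-mild clause is false -/

/-- **The GERM quadrichotomy with the Oseen-mild clause deleted is FALSE** (hypothesis of the tree theorem
`frobeniusProfileRigidity_of_germQuadrichotomy` verbatim, Oseen-mild line removed): the drifting cellular profile is
Type-I (`C = 4`), jointly continuous, divergence-free and helicity-free, and no non-empty open window of any of its
slices is vorticity-aligned (1), flat in a direction (2), germ-axisymmetric without swirl in a frame (3), or carries
an affine screw vorticity (4). Any proof of the germ quadrichotomy must use the Navier–Stokes identity. [folklore] -/
theorem germQuadrichotomy_false_without_mild :
    ¬ ∀ (C : ℝ) (v : ℝ → EuclideanSpace ℝ (Fin 3) → EuclideanSpace ℝ (Fin 3)),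
      HasTypeITimeDecay C v →
      ContinuousOn (Function.uncurry v) (Set.Iio (0 : ℝ) ×ˢ Set.univ) →
      (∀ t < 0, VectorCalculus.IsDivFree (v t)) →
      (∀ s < 0, ∀ y : EuclideanSpace ℝ (Fin 3), ⟪v s y, curl (v s) y⟫_ℝ = 0) →
      ∃ s < 0, ∃ U : Set (EuclideanSpace ℝ (Fin 3)), IsOpen U ∧ U.Nonempty ∧
        ((∃ b : EuclideanSpace ℝ (Fin 3), b ≠ 0 ∧ ∀ y ∈ U, cross (curl (v s) y) b = 0) ∨
         (∃ e : EuclideanSpace ℝ (Fin 3), e ≠ 0 ∧ ∀ y ∈ U, fderiv ℝ (v s) y e = 0) ∨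
         (∃ (L : EuclideanSpace ℝ (Fin 3) ≃ₗᵢ[ℝ] EuclideanSpace ℝ (Fin 3)) (c : EuclideanSpace ℝ (Fin 3)),
            ∀ y ∈ U, fderiv ℝ (fun y => L.symm (v s (L y + c))) y (rotGen y) = rotGen (L.symm (v s (L y + c))) ∧
              swirl (fun y => L.symm (v s (L y + c))) y = 0) ∨
         (∃ (k : ℝ) (c d : EuclideanSpace ℝ (Fin 3)) (h : ℝ), k ≠ 0 ∧ d ≠ 0 ∧
            ∀ y ∈ U, curl (v s) y = k • (cross d (y - c) + h • d))) := by
  intro H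
  obtain ⟨s, hs, U, hU, hne, halt⟩ := H 4 driftProfile hasTypeITimeDecay_driftProfile continuousOn_driftProfile
    (fun t _ => isDivFree_driftProfile t) (fun s _ y => helicityFree_driftProfile s y)
  rcases halt with ⟨b, hb, hal⟩ | ⟨e, he, hdir⟩ | ⟨L, c, hax⟩ | ⟨k, c, d, h, hk, hd, hsc⟩
  · exact driftProfile_no_aligned_vorticity_window hs ⟨U, b, hU, hne, hb, hal⟩
  · exact driftProfile_no_flat_direction_window hs ⟨U, e, hU, hne, he, hdir⟩
  · exact driftProfile_no_noSwirl_window hs L c ⟨U, hU, hne, fun y hy => (hax y hy).2⟩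
  · exact driftProfile_no_affineScrew_vorticity_ball hs ⟨k, c, d, h, U, hk, hd, hU, hne, hsc⟩

end Summit.NavierStokesRegularity.NavierStokesRegularity.Theorems.PoloidalWindowRigidity.Negative

end
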